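import Summits.QuantumFields.YangMills.Theorems.FemtoCutoffLadderTowerTelescopingEventually
import Summits.QuantumFields.YangMills.Theorems.FemtoCutoffLadderSubOctaveBoundedUpStepDoor
import Summits.QuantumFields.YangMills.Theorems.FemtoCutoffLadderAssembly2

/-!
# Crux `SubOctaveBounded` (stmt-QuantumFields-24085; routes `FemtoCutoffLadder` r4, `FlatTubeReduction` r5) — RESHAPE CERTIFICATES:
# both routes close the leaf `FemtoGapOfRecord` from the incommensurable step (a) in EVENTUALLY form and (b) in the OPPOSITE direction

Seat `ym-line-fcl-p3` (2026-08-28).  Rung R2b1 = the RECORD-label femto transfer gap — not infinite volume, not the Clay mass gap; no summit is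
proved by anything here.

The item as filed (verbatim body of `Theses.FemtoCutoffLadder.SubOctaveBounded` = `Theses.FlatTubeReduction.SubOctaveBounded`):
`∃ C lam0 L₀, … ∀ lam ≤ lam0, ∀ L₀ ≤ L' ≤ L < 2L'` at matched running parameter, `λ₁(β,L)^L·λ₀(β',L')^{L'} ≤ e^{CΛ²}·λ₁(β',L')^{L'}·λ₀(β,L)^L`
— threshold BEFORE the level, direction «coarse below fine» (`z̃(Λ,L') ≤ z̃(Λ,L) + CΛ²`, `L` fine: a LOWER bound on the fine gap).
Both proved assemblies use it only through `OctaveStepDecay → SubOctaveBounded → FemtoGapFixedLattice → FemtoGapOfRecord`.  This module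
records, with the route decls BY NAME, that the same conclusion follows from either of two other step statements (bodies spelled out; the
route-independent ladders are `CutoffLadder.femtoGapOfRecord_of_towerLadder_eventually` / `_up`):

* ★ `femtoGapOfRecord_of_octave_subOctaveEventually_fixedLattice` — the filed direction with the threshold AFTER the level (`∀ lam, ∃ L₀`,
  the leaf's own quantifier pattern); `subOctaveBoundedEventually_of_subOctaveBounded` (filed ⟹ eventually: the reshaped statement is weaker).
* ★★ `femtoGapOfRecord_of_octave_upStep_fixedLattice` — the OPPOSITE direction «fine below coarse» for pairs `L₀ ≤ L' < L < 2L'`,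
  `λ₁(β',L')^{L'}·λ₀(β,L)^L ≤ e^{CΛ²}·λ₁(β,L)^L·λ₀(β',L')^{L'}` (an UPPER bound on the fine gap: the variational direction), threshold after
  the level; `upStep_of_uniformStepScaling` (it is the second conjunct of the retired two-sided `UniformStepScaling`, dropped at rev 2 as idle),
  `upStepEventually_of_upStep`.
* ★★★ `femtoGapOfRecord_of_octave_dynComparison_fixedLattice` — composed with the spectral door `UpStep.upStepEventually_of_dynComparison`
  (`FemtoCutoffLadderSubOctaveBoundedUpStepDoor.lean`): `OctaveStepDecay →` [VACUUM-CHAIN COMPARISON: for every fine normalised exact ground state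
  `Ω` some physical `v ⊥ Ω` has physical-time-1 autocorrelation `⟨v,K_β^L v⟩/(λ₀^L‖v‖²) ≥ e^{−CΛ²}(λ₁'/λ₀')^{L'}`] `→ FemtoGapFixedLattice →
  FemtoGapOfRecord`.  This is the residual form of the incommensurable crux after this seat's work: a two-cutoff comparison of two-time VACUUM
  expectations of one observable (intended: the coarse excitation pulled back along the thinning map of `FemtoCutoffLadderThinningDefs`).
* Route `FlatTubeReduction` (shared items 24153/24085, same bodies): its proved K2 gives `NearFlatRatioLaw → FemtoGapFixedLattice`
  (`FlatTubeReduction.femtoGapFixedLattice_of_nearFlatRatioLaw`), which composes with each theorem here in one line (not restated, to keep this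
  file inside ONE route's cone).

WHY IT MATTERS (for the planner; no claim that either reshaped step is proved): in the ground-state representation of the fine transfer
operator over physical time `1`, `1 − e^{−z̃(Λ,L)}` is the bottom of a Dirichlet-form spectrum; the filed direction lower-bounds it (a
Poincaré inequality on the fine lattice given one on the coarse lattice — gap non-collapse under refinement, the same KIND of statement as
`OctaveStepDecay`), whereas the upward direction upper-bounds it (ONE slow test observable, e.g. the pulled-back coarse excitation, suffices).
The one-loop lattice coefficients of the instrument row (kit job j297336: `γ₁(N) = 0, +0.0025, −0.121, −0.205, −0.246, … → −0.301`) make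
`z̃` DEcrease in `L ≥ 2` at fixed `Λ`, i.e. the upward inequality is the numerically slack one.

HONEST FRAMING: bookkeeping only; the reshaped steps are still two-cutoff comparisons deep in the femto window (barrier
`UVStabilityNonUniqueness`).  No definitions, no named facts, no `sorry`.
-/

set_option autoImplicit false

namespace Summit.QuantumFields.YangMills.Theorems.FemtoCutoffLadder

open Real
open Summit.QuantumFields.YangMills.Theorems.FemtoTransferGap
open Summit.QuantumFields.YangMills.Theses.FemtoCutoffLadder

/-! ## §1 Coarse pairs in ladder form -/

/-- `CoarsePairScaling` (stmt-QuantumFields-23866) read at exponent `1` — the (hP) hypothesis of the tower ladders. [cite: Luscher1983, §3] -/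
theorem coarsePairs_pow_of_coarsePairScaling (h : CoarsePairScaling) :
    ∀ (L : ℕ) [NeZero L], ∃ C lam0 : ℝ, 0 < lam0 ∧ ∀ lam : ℝ, 0 < lam → lam ≤ lam0 →
      ∀ β β' : ℝ, InFemtoWindow lam β L → InFemtoWindow lam β' 1 → luscherLambda β L = luscherLambda β' 1 →
        secondValue su2Rep L β ^ L * topValue su2Rep 1 β' ^ 1 ≤
          Real.exp (C * luscherLambda β L ^ 2) * (secondValue su2Rep 1 β' ^ 1 * topValue su2Rep L β ^ L) := by
  intro L _
  obtain ⟨C, lam0, hlam0, H⟩ := h L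
  refine ⟨C, lam0, hlam0, fun lam hlam hle β β' hW hW' hm => ?_⟩
  simpa only [pow_one] using H lam hlam hle β β' hW hW' hm

/-! ## §2 The filed direction with the threshold after the level -/

/-- ★ **Route FemtoCutoffLadder from the EVENTUALLY form of `SubOctaveBounded`.**  `OctaveStepDecay` (stmt-QuantumFields-24153, by name) →
[the body of `SubOctaveBounded` with `∃ L₀` moved AFTER `∀ lam`] → `FemtoGapFixedLattice` (tree leaf = node `FixedLatticeLaw`) → `FemtoGapOfRecord`
— coarse pairs from the leaf (`coarsePairScaling_of_fixedLattice`, glue 23945 + one-site upper 23944, closed), anchor (23508, closed), matching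
(23770, closed), ladder `CutoffLadder.femtoGapOfRecord_of_towerLadder_eventually`. [cite: LuscherWeiszWolff1991] [cite: Luscher1983, §3] -/
theorem femtoGapOfRecord_of_octave_subOctaveEventually_fixedLattice (h₁ : OctaveStepDecay)
    (h₂ : ∃ C lam0 : ℝ, 0 < lam0 ∧ ∀ lam : ℝ, 0 < lam → lam ≤ lam0 → ∃ L0 : ℕ,
      ∀ (L' : ℕ) [NeZero L'] (L : ℕ) [NeZero L], L0 ≤ L' → L' ≤ L → L < 2 * L' →
        ∀ β β' : ℝ, InFemtoWindow lam β L → InFemtoWindow lam β' L' → luscherLambda β L = luscherLambda β' L' →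
          secondValue su2Rep L β ^ L * topValue su2Rep L' β' ^ L' ≤
            Real.exp (C * luscherLambda β L ^ 2) * (secondValue su2Rep L' β' ^ L' * topValue su2Rep L β ^ L))
    (hFL : FemtoGapFixedLattice) : FemtoGapOfRecord :=
  CutoffLadder.femtoGapOfRecord_of_towerLadder_eventually h₁ h₂
    (coarsePairs_pow_of_coarsePairScaling (coarsePairScaling_of_fixedLattice hFL))
    oneSiteWindowAnchor_proof matchedCouplingExists_proof

/-- The item AS FILED implies its eventually form (a threshold fixed before the level serves every level): the reshaped statement is weaker.
[folklore] -/
theorem subOctaveBoundedEventually_of_subOctaveBounded (h : SubOctaveBounded) :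
    ∃ C lam0 : ℝ, 0 < lam0 ∧ ∀ lam : ℝ, 0 < lam → lam ≤ lam0 → ∃ L0 : ℕ,
      ∀ (L' : ℕ) [NeZero L'] (L : ℕ) [NeZero L], L0 ≤ L' → L' ≤ L → L < 2 * L' →
        ∀ β β' : ℝ, InFemtoWindow lam β L → InFemtoWindow lam β' L' → luscherLambda β L = luscherLambda β' L' →
          secondValue su2Rep L β ^ L * topValue su2Rep L' β' ^ L' ≤
            Real.exp (C * luscherLambda β L ^ 2) * (secondValue su2Rep L' β' ^ L' * topValue su2Rep L β ^ L) := by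
  obtain ⟨C, lam0, L0, hlam0, H⟩ := h
  exact ⟨C, lam0, hlam0, fun lam hlam hle => ⟨L0, fun L' _ L _ hL0 hle' hlt β β' hW hW' hm =>
    H lam hlam hle L' L hL0 hle' hlt β β' hW hW' hm⟩⟩

/-! ## §3 The opposite direction: one bounded step «fine below coarse» (the tower partner above the lattice) -/

/-- ★★ **Route FemtoCutoffLadder from the UPWARD incommensurable step.**  `OctaveStepDecay` (by name) → [ONE bounded step «fine below coarse»:
`∃ C lam0, ∀ lam ≤ lam0, ∃ L₀, ∀ L₀ ≤ L' < L < 2L'` matched, `λ₁(β',L')^{L'}·λ₀(β,L)^L ≤ e^{CΛ²}·λ₁(β,L)^L·λ₀(β',L')^{L'}`] → `FemtoGapFixedLattice`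
→ `FemtoGapOfRecord` — ladder `CutoffLadder.femtoGapOfRecord_of_towerLadder_up` (for an arbitrary lattice the chain's lower law on the tower
lattice just ABOVE it is pulled down by the step), coarse pairs from the leaf, closed anchor and matching. [cite: LuscherWeiszWolff1991]
[cite: Luscher1983, §3] -/
theorem femtoGapOfRecord_of_octave_upStep_fixedLattice (h₁ : OctaveStepDecay)
    (hU : ∃ C lam0 : ℝ, 0 < lam0 ∧ ∀ lam : ℝ, 0 < lam → lam ≤ lam0 → ∃ L0 : ℕ,
      ∀ (L' : ℕ) [NeZero L'] (L : ℕ) [NeZero L], L0 ≤ L' → L' < L → L < 2 * L' →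
        ∀ β β' : ℝ, InFemtoWindow lam β L → InFemtoWindow lam β' L' → luscherLambda β L = luscherLambda β' L' →
          secondValue su2Rep L' β' ^ L' * topValue su2Rep L β ^ L ≤
            Real.exp (C * luscherLambda β L ^ 2) * (secondValue su2Rep L β ^ L * topValue su2Rep L' β' ^ L'))
    (hFL : FemtoGapFixedLattice) : FemtoGapOfRecord :=
  CutoffLadder.femtoGapOfRecord_of_towerLadder_up h₁ hU
    (coarsePairs_pow_of_coarsePairScaling (coarsePairScaling_of_fixedLattice hFL))
    oneSiteWindowAnchor_proof matchedCouplingExists_proof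

/-- **The upward step is the dropped conjunct of the retired r2.**  `UniformStepScaling` (stmt-QuantumFields-23506/23836, two-sided, all pairs
`L₀ ≤ L' ≤ L ≤ 2L'`, slack `e^{CΛ²/L'^σ}`, threshold before the level) gives the UNIFORM upward step with slack `e^{max(C,0)Λ²}`
(`L'^{−σ} ≤ 1`). [cite: LuscherWeiszWolff1991] -/
theorem upStep_of_uniformStepScaling (h : UniformStepScaling) :
    ∃ (C lam0 : ℝ) (L0 : ℕ), 0 < lam0 ∧ ∀ lam : ℝ, 0 < lam → lam ≤ lam0 →
      ∀ (L' : ℕ) [NeZero L'] (L : ℕ) [NeZero L], L0 ≤ L' → L' ≤ L → L ≤ 2 * L' →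
        ∀ β β' : ℝ, InFemtoWindow lam β L → InFemtoWindow lam β' L' → luscherLambda β L = luscherLambda β' L' →
          secondValue su2Rep L' β' ^ L' * topValue su2Rep L β ^ L ≤
            Real.exp (C * luscherLambda β L ^ 2) * (secondValue su2Rep L β ^ L * topValue su2Rep L' β' ^ L') := by
  obtain ⟨C, σ, lam0, L0, hσ, hlam0, H⟩ := h
  refine ⟨max C 0, lam0, L0, hlam0, fun lam hlam hle L' _ L _ hL0 hle' hle2 β β' hW hW' hm => ?_⟩
  have h2 := (H lam hlam hle L' L hL0 hle' hle2 β β' hW hW' hm).2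
  refine h2.trans (CutoffLadder.exp_mul_le_exp_mul ?_ ?_)
  · have hw : ((L' : ℝ) ^ σ)⁻¹ ≤ 1 := CutoffLadder.potential_le_one hσ.le L'
    have hw0 : 0 ≤ ((L' : ℝ) ^ σ)⁻¹ := inv_nonneg.mpr (Real.rpow_nonneg (Nat.cast_nonneg L') σ)
    have hΛ : 0 ≤ luscherLambda β L ^ 2 := sq_nonneg _
    calc C * luscherLambda β L ^ 2 / (L' : ℝ) ^ σ = C * (luscherLambda β L ^ 2 * ((L' : ℝ) ^ σ)⁻¹) := by ring
      _ ≤ max C 0 * (luscherLambda β L ^ 2 * ((L' : ℝ) ^ σ)⁻¹) :=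
          mul_le_mul_of_nonneg_right (le_max_left _ _) (mul_nonneg hΛ hw0)
      _ ≤ max C 0 * (luscherLambda β L ^ 2 * 1) :=
          mul_le_mul_of_nonneg_left (mul_le_mul_of_nonneg_left hw hΛ) (le_max_right _ _)
      _ = max C 0 * luscherLambda β L ^ 2 := by ring
  · exact mul_nonneg (pow_nonneg (secondValue_su2Rep_pos (by linarith [hW.1])).le _)
      (pow_nonneg (topValue_su2Rep_pos L' β').le _)

/-- A uniform upward step (threshold before the level, pairs `L' ≤ L ≤ 2L'`) gives the eventually form on the strict pairs `L' < L < 2L'` that the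
upward ladder consumes. [folklore] -/
theorem upStepEventually_of_upStep
    (h : ∃ (C lam0 : ℝ) (L0 : ℕ), 0 < lam0 ∧ ∀ lam : ℝ, 0 < lam → lam ≤ lam0 →
      ∀ (L' : ℕ) [NeZero L'] (L : ℕ) [NeZero L], L0 ≤ L' → L' ≤ L → L ≤ 2 * L' →
        ∀ β β' : ℝ, InFemtoWindow lam β L → InFemtoWindow lam β' L' → luscherLambda β L = luscherLambda β' L' →
          secondValue su2Rep L' β' ^ L' * topValue su2Rep L β ^ L ≤
            Real.exp (C * luscherLambda β L ^ 2) * (secondValue su2Rep L β ^ L * topValue su2Rep L' β' ^ L')) :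
    ∃ C lam0 : ℝ, 0 < lam0 ∧ ∀ lam : ℝ, 0 < lam → lam ≤ lam0 → ∃ L0 : ℕ,
      ∀ (L' : ℕ) [NeZero L'] (L : ℕ) [NeZero L], L0 ≤ L' → L' < L → L < 2 * L' →
        ∀ β β' : ℝ, InFemtoWindow lam β L → InFemtoWindow lam β' L' → luscherLambda β L = luscherLambda β' L' →
          secondValue su2Rep L' β' ^ L' * topValue su2Rep L β ^ L ≤
            Real.exp (C * luscherLambda β L ^ 2) * (secondValue su2Rep L β ^ L * topValue su2Rep L' β' ^ L') := by
  obtain ⟨C, lam0, L0, hlam0, H⟩ := h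
  exact ⟨C, lam0, hlam0, fun lam hlam hle => ⟨L0, fun L' _ L _ hL0 hlt hlt2 β β' hW hW' hm =>
    H lam hlam hle L' L hL0 hlt.le hlt2.le β β' hW hW' hm⟩⟩

/-- Consistency: the retired two-sided r2 together with the tower step and the fixed-lattice leaf closes the leaf THROUGH THE UPWARD LADDER
(its first conjunct is not used): `OctaveStepDecay → UniformStepScaling → FemtoGapFixedLattice → FemtoGapOfRecord`. [cite: LuscherWeiszWolff1991] -/
theorem femtoGapOfRecord_of_octave_uniformStep_up_fixedLattice (h₁ : OctaveStepDecay) (h : UniformStepScaling)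
    (hFL : FemtoGapFixedLattice) : FemtoGapOfRecord :=
  femtoGapOfRecord_of_octave_upStep_fixedLattice h₁ (upStepEventually_of_upStep (upStep_of_uniformStepScaling h)) hFL

/-! ## §3b The route from the vacuum-chain comparison (spectral door composed in) -/

/-- ★★★ **Route FemtoCutoffLadder from the VACUUM-CHAIN COMPARISON.**  `OctaveStepDecay` → [for all deep-window incommensurable pairs
`L₀ ≤ L' < L < 2L'` at matched running parameter and every physical normalised exact ground state `Ω` of the fine transfer operator, some physical
`v ⊥ Ω`, `v ≠ 0`, with `λ₁(β',L')^{L'}·λ₀(β,L)^L·‖v‖² ≤ e^{CΛ²}·λ₀(β',L')^{L'}·⟨v, K_β^L v⟩`] → `FemtoGapFixedLattice` → `FemtoGapOfRecord`: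
the spectral door `UpStep.upStepEventually_of_dynComparison` (variational lower bound for `λ₁^L` from one trial vector) feeds the upward ladder.
[cite: ReedSimonIV1978, Thm. XIII.1] [cite: LuscherWeiszWolff1991] -/
theorem femtoGapOfRecord_of_octave_dynComparison_fixedLattice (h₁ : OctaveStepDecay)
    (hD : ∃ C lam0 : ℝ, 0 < lam0 ∧ ∀ lam : ℝ, 0 < lam → lam ≤ lam0 → ∃ L0 : ℕ,
      ∀ (L' : ℕ) [NeZero L'] (L : ℕ) [NeZero L], L0 ≤ L' → L' < L → L < 2 * L' →
        ∀ β β' : ℝ, InFemtoWindow lam β L → InFemtoWindow lam β' L' → luscherLambda β L = luscherLambda β' L' →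
          ∀ Ω : Literature.MathematicalPhysics.QuantumFieldTheory.GaugeConfig 3 L SU2 → ℝ, IsPhys Ω → l2 Ω Ω = 1 →
            transferApply β Ω = topValue su2Rep L β • Ω →
            ∃ v : Literature.MathematicalPhysics.QuantumFieldTheory.GaugeConfig 3 L SU2 → ℝ, IsPhys v ∧ l2 v Ω = 0 ∧ 0 < l2 v v ∧
              secondValue su2Rep L' β' ^ L' * topValue su2Rep L β ^ L * l2 v v ≤
                Real.exp (C * luscherLambda β L ^ 2) * (topValue su2Rep L' β' ^ L' * l2 v ((transferApply β)^[L] v)))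
    (hFL : FemtoGapFixedLattice) : FemtoGapOfRecord :=
  femtoGapOfRecord_of_octave_upStep_fixedLattice h₁ (UpStep.upStepEventually_of_dynComparison hD) hFL

end Summit.QuantumFields.YangMills.Theorems.FemtoCutoffLadder
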